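import Summits.RiemannHypothesis.RiemannHypothesis.Theorems.HandoffSchur
import Literature.NumberTheory.LFunctions.WeilSmallSupportPositivity
import Mathlib.Analysis.SpecialFunctions.SmoothTransition
import HarnessLib

/-!
# HANDOFF, edge block: the two-lobe split and the reduction of `EdgeNonneg` to a CROSS-TERM bound (rh-explicit, track «HANDOFF», seat prove-2, ATTEMPT-4)

HONEST FRAMING. Nothing here bears on RH. The edge block `C` of the Schur decomposition (`EdgeNonneg q q′ η` of
`HandoffSchur.lean`: Weil positivity on two-lobe edge functions of the window of the consecutive primes `q < q′`) is
reduced to ONE analytic estimate, the cross-term bound `HandoffCrossBound` (ATTEMPT-4 §2 (b)–(d): polar mass of the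
prime-free gap + archimedean tail + prime powers in the gap), everything else being PROVED here:

* `edgeLobeRight`, `edgeLobeLeft` — the smooth split `h = h₊ + h₋` of an edge-layer function by a `Real.smoothTransition`
  step across the (empty) inner core; supports `⊆ [c′, b]` resp. `[−b, −c′]`, `c′ = (log q)/2 − η` (PROVED).
* `re_weilQuadratic_lobe_ge` — the SELF-TERM bound for one lobe: `Re Q(f) ≥ (log(1/D) − log⁺log(1/D) − 8)·∫|f|²` for a
  Weil test function supported in an interval of length `D < log 2`, from the tree's `Bombieri2000Thm12_symmetric` by
  translation (`weilQuadratic_translate`) (PROVED).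
* `edgeNonneg_of_crossBound` — `HandoffCrossBound q q′ η X` together with `X b ≤ log(1/D_b) − log⁺log(1/D_b) − 8`
  (`D_b = b − c′`) on the window gives `EdgeNonneg q q′ η` (PROVED). With ATTEMPT-4's explicit
  `X b = (e^b + 1)·D_b + 1.05 q^{−1/2} D_b + 2·T_pp(q)`-type bound this is the prime-gap inequality (GAP-q); the bound
  itself is the remaining typed obligation (stated as the `Prop` `HandoffCrossBound`, NOT claimed).
-/

set_option linter.dupNamespace false

noncomputable section

open Complex Filter Set MeasureTheory Literature.NumberTheory.LFunctions
open scoped Real Topology ComplexConjugate ContDiff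

namespace Summit.RiemannHypothesis.RiemannHypothesis.Theorems.Handoff

variable {f g h : ℝ → ℂ} {q q' : ℕ}

/-! ## §1 The self-term bound for one lobe (Bombieri's Theorem 12 translated) -/

/-- **Self-energy of a lobe.** A Weil test function supported in an interval `[c, d]` of length `0 < d − c < log 2`
has `Re Q(f) ≥ (log(1/(d−c)) − log⁺log(1/(d−c)) − 8)·∫‖f‖²` (Bombieri 2000 Thm 12 on `[−a, a]`, `2a = d − c`, moved to
`[c, d]` by translation invariance). [cite: Bombieri2000, §12 Thm. 12; translation = folklore] -/
theorem re_weilQuadratic_lobe_ge (hf : IsWeilTest f) {c d : ℝ} (hcd : c < d) (hlen : d - c < Real.log 2)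
    (hsupp : tsupport f ⊆ Icc c d) :
    (Real.log (1 / (d - c)) - Real.posLog (Real.log (1 / (d - c))) - 8) * ∫ t : ℝ, ‖f t‖ ^ 2 ≤
      (weilQuadratic f).re := by
  set m : ℝ := (c + d) / 2 with hm
  set a : ℝ := (d - c) / 2 with ha_def
  have ha : 0 < a := by rw [ha_def]; linarith
  have h2a : 2 * a < Real.log 2 := by rw [ha_def]; linarith
  set g : ℝ → ℂ := fun x ↦ f (x + m) with hg_def
  have hg : IsWeilTest g := isWeilTest_recentre hf m
  have hsupp' : tsupport f ⊆ Icc (m - a) (m + a) := by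
    have e1 : m - a = c := by rw [hm, ha_def]; ring
    have e2 : m + a = d := by rw [hm, ha_def]; ring
    rwa [e1, e2]
  have hgs : tsupport g ⊆ Icc (-a) a := tsupport_recentre_subset hsupp'
  have hB := Bombieri2000Thm12_symmetric hg ha h2a hgs
  have hback : (fun x ↦ g (x - m)) = f := by
    funext x
    simp [hg_def]
  have hQ : weilQuadratic g = weilQuadratic f := by
    rw [← hback, weilQuadratic_translate]
  have hN : ∫ t : ℝ, ‖g t‖ ^ 2 = ∫ t : ℝ, ‖f t‖ ^ 2 := by
    simp only [hg_def]
    exact integral_add_right_eq_self (fun t : ℝ ↦ ‖f t‖ ^ 2) m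
  have e3 : 2 * a = d - c := by rw [ha_def]; ring
  rw [e3, hN, hQ] at hB
  exact hB

/-! ## §2 The smooth two-lobe split of an edge-layer function -/

/-- The smooth step across the inner core: `0` on `(−∞, −c]`, `1` on `[c, ∞)` (`c > 0`). [folklore] -/
def edgeStep (c : ℝ) (x : ℝ) : ℝ :=
  Real.smoothTransition ((x + c) / (2 * c))

/-- The step is smooth. [folklore] -/
theorem contDiff_edgeStep (c : ℝ) : ContDiff ℝ ∞ (edgeStep c) :=
  Real.smoothTransition.contDiff.comp ((contDiff_id.add contDiff_const).div_const _)

/-- The step vanishes on `(−∞, −c]`. [folklore] -/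
theorem edgeStep_of_le_neg {c x : ℝ} (hc : 0 < c) (hx : x ≤ -c) : edgeStep c x = 0 :=
  Real.smoothTransition.zero_of_nonpos (div_nonpos_of_nonpos_of_nonneg (by linarith) (by linarith))

/-- The step equals `1` on `[c, ∞)`. [folklore] -/
theorem edgeStep_of_le {c x : ℝ} (hc : 0 < c) (hx : c ≤ x) : edgeStep c x = 1 :=
  Real.smoothTransition.one_of_one_le (by rw [le_div_iff₀ (by linarith)]; linarith)

/-- The right lobe `h₊ := χ·h` of an edge-layer function. [this track, ATTEMPT-4 §2] -/
def edgeLobeRight (c : ℝ) (h : ℝ → ℂ) : ℝ → ℂ :=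
  fun x ↦ (edgeStep c x : ℂ) * h x

/-- The left lobe `h₋ := (1 − χ)·h`. [this track, ATTEMPT-4 §2] -/
def edgeLobeLeft (c : ℝ) (h : ℝ → ℂ) : ℝ → ℂ :=
  fun x ↦ ((1 - edgeStep c x : ℝ) : ℂ) * h x

/-- `h = h₊ + h₋`. [folklore] -/
theorem edgeLobeRight_add_edgeLobeLeft (c : ℝ) (h : ℝ → ℂ) : edgeLobeRight c h + edgeLobeLeft c h = h := by
  funext x
  simp only [edgeLobeRight, edgeLobeLeft, Pi.add_apply]
  push_cast
  ring

/-- The right lobe is a Weil test function. [folklore] -/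
theorem isWeilTest_edgeLobeRight (c : ℝ) (hh : IsWeilTest h) : IsWeilTest (edgeLobeRight c h) :=
  ⟨(Complex.ofRealCLM.contDiff.comp (contDiff_edgeStep c)).mul hh.1, hh.2.mul_left⟩

/-- The left lobe is a Weil test function. [folklore] -/
theorem isWeilTest_edgeLobeLeft (c : ℝ) (hh : IsWeilTest h) : IsWeilTest (edgeLobeLeft c h) :=
  ⟨(Complex.ofRealCLM.contDiff.comp (contDiff_const.sub (contDiff_edgeStep c))).mul hh.1, hh.2.mul_left⟩

/-- Support of the right lobe of an edge-layer function: `⊆ [c, b]`. [this track, ATTEMPT-4 §2] -/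
theorem tsupport_edgeLobeRight_subset {c b : ℝ} (hc : 0 < c) (hsupp : tsupport h ⊆ Icc (-b) b)
    (hcore : ∀ x : ℝ, |x| < c → h x = 0) : tsupport (edgeLobeRight c h) ⊆ Icc c b := by
  refine closure_minimal ?_ isClosed_Icc
  intro x hx
  rw [Function.mem_support] at hx
  have hhx : h x ≠ 0 := fun h0 ↦ hx (by simp [edgeLobeRight, h0])
  have hχ : edgeStep c x ≠ 0 := fun h0 ↦ hx (by simp [edgeLobeRight, h0])
  have hxb : x ∈ Icc (-b) b := hsupp (subset_tsupport _ (Function.mem_support.2 hhx))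
  have hxc : c ≤ |x| := not_lt.1 fun hlt ↦ hhx (hcore x hlt)
  have hxgt : -c < x := by
    by_contra hle
    exact hχ (edgeStep_of_le_neg hc (not_lt.1 hle))
  refine ⟨?_, hxb.2⟩
  rcases le_or_gt 0 x with h0 | h0
  · rwa [abs_of_nonneg h0] at hxc
  · rw [abs_of_neg h0] at hxc
    linarith

/-- Support of the left lobe: `⊆ [−b, −c]`. [this track, ATTEMPT-4 §2] -/
theorem tsupport_edgeLobeLeft_subset {c b : ℝ} (hc : 0 < c) (hsupp : tsupport h ⊆ Icc (-b) b)
    (hcore : ∀ x : ℝ, |x| < c → h x = 0) : tsupport (edgeLobeLeft c h) ⊆ Icc (-b) (-c) := by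
  refine closure_minimal ?_ isClosed_Icc
  intro x hx
  rw [Function.mem_support] at hx
  have hhx : h x ≠ 0 := fun h0 ↦ hx (by simp [edgeLobeLeft, h0])
  have hχ : (1 - edgeStep c x) ≠ 0 := fun h0 ↦ hx (by
    simp only [edgeLobeLeft]
    rw [h0]; simp)
  have hxb : x ∈ Icc (-b) b := hsupp (subset_tsupport _ (Function.mem_support.2 hhx))
  have hxc : c ≤ |x| := not_lt.1 fun hlt ↦ hhx (hcore x hlt)
  have hxlt : x < c := by
    by_contra hle
    exact hχ (by rw [edgeStep_of_le hc (not_lt.1 hle)]; ring)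
  refine ⟨hxb.1, ?_⟩
  rcases le_or_gt 0 x with h0 | h0
  · rw [abs_of_nonneg h0] at hxc
    linarith
  · rw [abs_of_neg h0] at hxc
    linarith

/-! ## §3 The cross-term obligation and the reduction -/

/-- **The CROSS-TERM BOUND (the remaining analytic obligation of the edge block).** For every half-width `b` in the
window and every pair of Weil test functions `f`, `g` supported in the right resp. left edge layer
(`[c′, b]`, `[−b, −c′]`, `c′ = (log q)/2 − η`), the cross terms of Weil's form satisfy
`|Re(W(f ⋆ g̃) + W(g ⋆ f̃))| ≤ X(b)·(∫|f|² + ∫|g|²)`. ATTEMPT-4 §2 (b)–(d) derives it with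
`X(b) = ((e^b + 1) + 1.05 q^{−1/2})·(b − c′) + 2·Σ_{p^m ∈ (q e^{−2η}, e^{2b})} log p/p^{m/2}` (polar mass of the prime-free gap,
archimedean tail, prime powers in the gap); stated here as the typed obligation, NOT claimed. [this track, ATTEMPT-4 §2] -/
def HandoffCrossBound (q q' : ℕ) (η : ℝ) (X : ℝ → ℝ) : Prop :=
  ∀ b ∈ Icc (Real.log q / 2) (Real.log q' / 2), ∀ f g : ℝ → ℂ, IsWeilTest f → IsWeilTest g →
    tsupport f ⊆ Icc (Real.log q / 2 - η) b → tsupport g ⊆ Icc (-b) (-(Real.log q / 2 - η)) →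
      |(weilFunctional (weilConv f (weilReflect g)) + weilFunctional (weilConv g (weilReflect f))).re| ≤
        X b * ((∫ t : ℝ, ‖f t‖ ^ 2) + ∫ t : ℝ, ‖g t‖ ^ 2)

/-- **Reduction of the edge block to the cross-term bound.** For consecutive primes `q < q′`, an overlap
`0 < η < min((log q)/2, (log 2)/2)`, a cross-term bound `X` on the window, and the inequality
`X(b) ≤ log(1/D_b) − log⁺log(1/D_b) − 8` (`D_b = b − ((log q)/2 − η)`) for every `b` in the window: `EdgeNonneg q q′ η`.
(Split `h = h₊ + h₋`; `Re Q(h) = Re Q(h₊) + Re Q(h₋) + Re(cross) ≥ (L − X)(‖h₊‖² + ‖h₋‖²) ≥ 0`.)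
[this track, ATTEMPT-4 §2; cite: Bombieri2000, §12 Thm. 12 for the lobes] -/
theorem edgeNonneg_of_crossBound (hcons : ConsecutivePrimes q q') {η : ℝ} (hη : 0 < η)
    (hη' : η < Real.log q / 2) (hη2 : η < Real.log 2 / 2) {X : ℝ → ℝ} (hX : HandoffCrossBound q q' η X)
    (hL : ∀ b ∈ Icc (Real.log q / 2) (Real.log q' / 2),
      X b ≤ Real.log (1 / (b - (Real.log q / 2 - η))) -
        Real.posLog (Real.log (1 / (b - (Real.log q / 2 - η)))) - 8) :
    EdgeNonneg q q' η := by
  intro b hb h hh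
  set c : ℝ := Real.log q / 2 - η with hc_def
  have hc : 0 < c := by rw [hc_def]; linarith
  -- the window is at most (log 2)/2 long (Bertrand)
  have hq0 : (0 : ℝ) < q := by exact_mod_cast hcons.1.pos
  have hwin : Real.log q' / 2 ≤ Real.log q / 2 + Real.log 2 / 2 := by
    have h2q : (q' : ℝ) ≤ 2 * q := by exact_mod_cast hcons.le_two_mul
    have hq'0 : (0 : ℝ) < q' := by exact_mod_cast hcons.2.1.pos
    have := Real.log_le_log hq'0 h2q
    rw [Real.log_mul (by norm_num) hq0.ne'] at this
    linarith
  have hcb : c < b := by rw [hc_def]; linarith [hb.1]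
  have hlen : b - c < Real.log 2 := by rw [hc_def]; linarith [hb.2]
  -- the lobes
  set hp := edgeLobeRight c h with hp_def
  set hm := edgeLobeLeft c h with hm_def
  have hhp : IsWeilTest hp := isWeilTest_edgeLobeRight c hh.1
  have hhm : IsWeilTest hm := isWeilTest_edgeLobeLeft c hh.1
  have hcore : ∀ x : ℝ, |x| < c → h x = 0 := fun x hx ↦ hh.2.2 x (by rw [hc_def] at hx; exact hx)
  have hps : tsupport hp ⊆ Icc c b := tsupport_edgeLobeRight_subset hc hh.2.1 hcore
  have hms : tsupport hm ⊆ Icc (-b) (-c) := tsupport_edgeLobeLeft_subset hc hh.2.1 hcore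
  -- self terms
  have hSp := re_weilQuadratic_lobe_ge hhp hcb hlen hps
  have hSm : (Real.log (1 / (b - c)) - Real.posLog (Real.log (1 / (b - c))) - 8) * ∫ t : ℝ, ‖hm t‖ ^ 2 ≤
      (weilQuadratic hm).re := by
    have h1 : (-c) - (-b) = b - c := by ring
    have := re_weilQuadratic_lobe_ge hhm (by linarith : -b < -c) (by rw [h1]; exact hlen) hms
    rwa [h1] at this
  -- cross terms
  have hXb := hX b hb hp hm hhp hhm (by rw [hc_def] at hps; exact hps) (by rw [hc_def] at hms; exact hms)
  have hLb := hL b hb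
  -- assemble
  have hsum : h = hp + hm := (edgeLobeRight_add_edgeLobeLeft c h).symm
  rw [hsum, weilQuadratic_add hhp hhm]
  simp only [Complex.add_re]
  have hnp : 0 ≤ ∫ t : ℝ, ‖hp t‖ ^ 2 := integral_nonneg fun _ ↦ by positivity
  have hnm : 0 ≤ ∫ t : ℝ, ‖hm t‖ ^ 2 := integral_nonneg fun _ ↦ by positivity
  have hcross := (abs_le.1 hXb).1
  rw [Complex.add_re, mul_add] at hcross
  have h1 := mul_le_mul_of_nonneg_right hLb hnp
  have h2 := mul_le_mul_of_nonneg_right hLb hnm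
  linarith

end Summit.RiemannHypothesis.RiemannHypothesis.Theorems.Handoff
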